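import Literature.RingTheory.LocalCohomology.CechDepth
import Mathlib.RingTheory.Regular.IsSMulRegular
import Mathlib.RingTheory.Ideal.AssociatedPrime.Finiteness
import HarnessLib

/-!
# Depth from the vanishing of local (Čech) cohomology

Topic `Literature/RingTheory/LocalCohomology`, sequel of `CechDepth.lean` (which proves: an
`M`-regular sequence of length `t` inside `√(y)` makes the extended Čech complex
`0 → M → ∏ M_{y_i} → ∏ M_{y_iy_j} → ⋯` exact in degrees `< t`). Here is the **converse**, for a
finitely generated module `M` over a Noetherian ring `R` (SGA 2 Exp. III, Prop. 3.3, (iv) ⇒ (i);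
Eisenbud, *The Geometry of Syzygies*, Prop. A1.16: "`depth(Q, M)` is the smallest `i` with
`H^i_Q(M) ≠ 0`"): if the extended Čech complex of `M` with respect to `y_1,…,y_s` is exact in
degrees `< n`, then there is an `M`-(weakly) regular sequence `x_1,…,x_n` with all `x_l` in the
ideal `J = (y_1,…,y_s)` itself (`exists_isWeaklyRegular_of_cech_exact`); if moreover `JM ≠ M` the
sequence is `M`-regular in Mathlib's sense (`exists_isRegular_of_cech_exact`), and together with
`cech_exact_of_isRegular` this gives the equivalence `cech_exact_iff_exists_isRegular`
("Čech depth = depth").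

Proof, as in SGA 2 III 3.3: induction on `n`. Injectivity of `M → ∏ M_{y_i}` says that no
non-zero element of `M` is killed by `J`, so `J` lies in no associated prime of `M` and prime
avoidance (Mathlib's `Ideal.subset_union_prime_finite`, `associatedPrimes.finite`,
`biUnion_associatedPrimes_eq_compl_regular`) produces an `M`-regular `x ∈ J`
(`exists_isSMulRegular_of_cechAug_injective`); the exactness of `Č(y; M/xM)` one degree lower
follows from that of `Č(y; M)` by diagram chases in the degreewise short exact sequences
`0 → Č(M) →x Č(M) → Č(M/xM) → 0` (`cech_quot_aug_injective`, `cech_quot_exact_zero`,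
`cech_quot_exact_succ` — the connecting-homomorphism-free form of the long exact cohomology
sequence), and Mathlib's `RingTheory.Sequence.isWeaklyRegular_cons_iff` assembles the sequence.

Everything is proved; no definitions, no named facts. Mathlib (pin v4.32) has Rees' theorem in
the `Ext` form (`ModuleCat.exists_isRegular_tfae`, depth via `Ext^i(R/I, M)`), but no comparison of
`Ext`/`localCohomology` with the Čech complex; this file stays in the Čech language of this
directory.

## References

* [Grothendieck1968SGA2] A. Grothendieck, SGA 2, Exp. III, Prop. 3.3 (iv) ⇒ (i)
  (arXiv:math/0511279, p. 17).
* [Eisenbud2005] D. Eisenbud, *The Geometry of Syzygies*, GTM 229, Appendix 1, Prop. A1.16.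
-/

noncomputable section

universe u

namespace Literature.RingTheory.LocalCohomology

variable {R : Type u} [CommRing R] {s : ℕ} {y : Fin s → R} {M : Type u} [AddCommGroup M]
  [Module R M]

open Pointwise

/-! ## Diagram chases in `0 → Č(M) →x Č(M) → Č(M/xM) → 0` -/

section Chase

variable {x : R}

/-- **Degree `0` of the long exact sequence**: if `M → Č⁰(M)` is injective and every cocycle of
`Č⁰(M)` comes from `M`, then `M/xM → Č⁰(M/xM)` is injective, for `x` regular on `M`.
[cite: Grothendieck1968SGA2, Exp. III 3.3] -/
theorem cech_quot_aug_injective (hx : IsSMulRegular M x)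
    (h0 : ∀ m : M, cechAug y M m = 0 → m = 0)
    (h1 : ∀ c : CechObj y M 0, dC 0 c = 0 → ∃ m : M, cechAug y M m = c)
    (m : QuotSMulTop x M) (hm : cechAug y (QuotSMulTop x M) m = 0) : m = 0 := by
  obtain ⟨m₀, rfl⟩ := toQuot_surjective (M := M) x m
  -- `ε m₀ ↦ 0` in `Č⁰(M/xM)`, so `ε m₀ = x e`
  have h : cechObjMap y (toQuot (M := M) x) 0 (cechAug y M m₀) = 0 := by
    rw [← cechAug_map]; exact hm
  obtain ⟨e, he⟩ := exists_eq_smul_of_cechObjMap_toQuot_eq_zero x 0 _ h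
  -- `x de = d(ε m₀) = 0`, so `e` is a cocycle, `e = ε m'`
  have hde : dC 0 e = 0 :=
    isSMulRegular_cechObj (y := y) hx 1 (show x • dC 0 e = x • (0 : CechObj y M 1) by
      rw [smul_zero, ← LinearMap.map_smul, ← he, dC_cechAug])
  obtain ⟨m', hm'⟩ := h1 e hde
  -- `ε (m₀ - x m') = 0`, so `m₀ = x m'`
  have h2 : m₀ - x • m' = 0 := h0 _ (by rw [map_sub, LinearMap.map_smul, hm', he, sub_self])
  rw [sub_eq_zero] at h2
  rw [h2, LinearMap.map_smul]
  exact smul_quot x _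

/-- **Degree `1` of the long exact sequence**: if every cocycle of `Č⁰(M)` comes from `M` and
every cocycle of `Č¹(M)` is a coboundary, then every cocycle of `Č⁰(M/xM)` comes from `M/xM`, for
`x` regular on `M`. [cite: Grothendieck1968SGA2, Exp. III 3.3] -/
theorem cech_quot_exact_zero (hx : IsSMulRegular M x)
    (h1 : ∀ c : CechObj y M 0, dC 0 c = 0 → ∃ m : M, cechAug y M m = c)
    (h2 : ∀ c : CechObj y M 1, dC 1 c = 0 → ∃ b : CechObj y M 0, dC 0 b = c)
    (c : CechObj y (QuotSMulTop x M) 0) (hc : dC 0 c = 0) :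
    ∃ m : QuotSMulTop x M, cechAug y (QuotSMulTop x M) m = c := by
  obtain ⟨c₀, rfl⟩ := cechObjMap_surjective y _ (toQuot_surjective (M := M) x) 0 c
  -- `d c₀ ↦ 0`, so `d c₀ = x e`
  have h : cechObjMap y (toQuot (M := M) x) 1 (dC 0 c₀) = 0 := by
    rw [← dC_cechObjMap]; exact hc
  obtain ⟨e, he⟩ := exists_eq_smul_of_cechObjMap_toQuot_eq_zero x 1 _ h
  have hde : dC 1 e = 0 :=
    isSMulRegular_cechObj (y := y) hx 2 (show x • dC 1 e = x • (0 : CechObj y M 2) by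
      rw [smul_zero, ← LinearMap.map_smul, ← he, dC_dC])
  obtain ⟨e', rfl⟩ := h2 e hde
  -- `c₀ - x e'` is a cocycle, hence `= ε m`
  have hcyc : dC 0 (c₀ - x • e') = 0 := by rw [map_sub, LinearMap.map_smul, he, sub_self]
  obtain ⟨m, hm⟩ := h1 _ hcyc
  refine ⟨toQuot x m, ?_⟩
  rw [cechAug_map, hm, map_sub, LinearMap.map_smul, smul_cechObj_quot, sub_zero]

/-- **Degrees `≥ 2` of the long exact sequence**: if every cocycle of `Č^{q+1}(M)` and of
`Č^{q+2}(M)` is a coboundary, then so is every cocycle of `Č^{q+1}(M/xM)`, for `x` regular on `M`.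
[cite: Grothendieck1968SGA2, Exp. III 3.3] -/
theorem cech_quot_exact_succ (hx : IsSMulRegular M x) (q : ℕ)
    (h1 : ∀ c : CechObj y M (q + 1), dC (q + 1) c = 0 → ∃ b : CechObj y M q, dC q b = c)
    (h2 : ∀ c : CechObj y M (q + 2), dC (q + 2) c = 0 →
      ∃ b : CechObj y M (q + 1), dC (q + 1) b = c)
    (c : CechObj y (QuotSMulTop x M) (q + 1)) (hc : dC (q + 1) c = 0) :
    ∃ b : CechObj y (QuotSMulTop x M) q, dC q b = c := by
  obtain ⟨c₀, rfl⟩ := cechObjMap_surjective y _ (toQuot_surjective (M := M) x) (q + 1) c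
  have h : cechObjMap y (toQuot (M := M) x) (q + 2) (dC (q + 1) c₀) = 0 := by
    rw [← dC_cechObjMap]; exact hc
  obtain ⟨e, he⟩ := exists_eq_smul_of_cechObjMap_toQuot_eq_zero x (q + 2) _ h
  have hde : dC (q + 2) e = 0 :=
    isSMulRegular_cechObj (y := y) hx (q + 3)
      (show x • dC (q + 2) e = x • (0 : CechObj y M (q + 3)) by
        rw [smul_zero, ← LinearMap.map_smul, ← he, dC_dC])
  obtain ⟨e', rfl⟩ := h2 e hde
  have hcyc : dC (q + 1) (c₀ - x • e') = 0 := by rw [map_sub, LinearMap.map_smul, he, sub_self]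
  obtain ⟨f, hf⟩ := h1 _ hcyc
  refine ⟨cechObjMap y (toQuot (M := M) x) q f, ?_⟩
  rw [dC_cechObjMap, hf, map_sub, LinearMap.map_smul, smul_cechObj_quot, sub_zero]

end Chase

/-! ## A regular element from the injectivity of `M → Č⁰(M)` -/

/-- If `m ∈ M` is killed by `J = (y_1,…,y_s)` then `ε(m) = 0` in `Č⁰(M) = ∏ M_{y_i}`. [folklore] -/
theorem cechAug_eq_zero_of_forall_smul_eq_zero (m : M)
    (hm : ∀ r ∈ Ideal.span (Set.range y), r • m = 0) : cechAug y M m = 0 := by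
  funext t
  rw [cechAug_apply, Pi.zero_apply, ← LocalizedModule.zero_mk 1, LocalizedModule.mk_eq]
  refine ⟨⟨tupleProd y t, Submonoid.mem_powers _⟩, ?_⟩
  have ht : tupleProd y t ∈ Ideal.span (Set.range y) := by
    rw [tupleProd, Fin.prod_univ_one]
    exact Ideal.subset_span ⟨t 0, rfl⟩
  simp only [smul_zero, one_smul, Submonoid.smul_def, hm _ ht]

/-- **If `M → ∏ M_{y_i}` is injective, some `x ∈ (y_1,…,y_s)` is `M`-regular** (`R` Noetherian,
`M` finitely generated): no associated prime of `M` contains `J = (y)` — an element with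
annihilator `⊇ J` dies in every `M_{y_i}` — so prime avoidance applies.
[cite: Grothendieck1968SGA2, Exp. III 3.3] -/
theorem exists_isSMulRegular_of_cechAug_injective [IsNoetherianRing R] [Module.Finite R M]
    (h0 : ∀ m : M, cechAug y M m = 0 → m = 0) :
    ∃ x ∈ Ideal.span (Set.range y), IsSMulRegular M x := by
  classical
  by_contra! h
  rcases subsingleton_or_nontrivial M with hM | hM
  · exact h 0 (Submodule.zero_mem _) fun a b _ => Subsingleton.elim a b
  have hsub : ((Ideal.span (Set.range y) : Ideal R) : Set R) ⊆
      ⋃ p ∈ associatedPrimes R M, (p : Set R) := by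
    rw [biUnion_associatedPrimes_eq_compl_regular R M]
    exact fun r hr => h r hr
  obtain ⟨Ia, hIa⟩ := associatedPrimes.nonempty R M
  obtain ⟨p, hp, hJp⟩ := (Ideal.subset_union_prime_finite (associatedPrimes.finite R M) Ia Ia
    (fun I hI _ _ => IsAssociatedPrime.isPrime hI)).mp hsub
  obtain ⟨hprime, m, hpm⟩ := isAssociatedPrime_iff.mp hp
  -- `J m = 0`, hence `ε m = 0`, hence `m = 0`, hence `p = R`: absurd
  have hm0 : m = 0 := h0 m (cechAug_eq_zero_of_forall_smul_eq_zero m fun r hr => by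
    have := hJp hr
    rw [hpm, Submodule.mem_colon_singleton, Submodule.mem_bot] at this
    exact this)
  refine hprime.ne_top ?_
  rw [hpm, hm0, eq_top_iff]
  intro r _
  rw [Submodule.mem_colon_singleton, smul_zero]
  exact Submodule.zero_mem _

/-! ## The converse of `cech_exact_of_isRegular` -/

/-- **Depth from the vanishing of Čech cohomology** (SGA 2 III 3.3, (iv) ⇒ (i)): for a finitely
generated module `M` over a Noetherian ring `R`, if the extended Čech complex
`0 → M → ∏ M_{y_i} → ∏ M_{y_iy_j} → ⋯` is exact in degrees `< n` (the three clauses, as in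
`cech_exact_of_isRegular`), then there is an `M`-weakly-regular sequence of length `n` with all
its members in the ideal `(y_1,…,y_s)`.
[cite: Grothendieck1968SGA2, Exp. III Prop. 3.3] [cite: Eisenbud2005, Prop. A1.16] -/
theorem exists_isWeaklyRegular_of_cech_exact [IsNoetherianRing R] (n : ℕ) :
    ∀ (M : Type u) [AddCommGroup M] [Module R M] [Module.Finite R M],
      (0 < n → ∀ m : M, cechAug y M m = 0 → m = 0) →
      (1 < n → ∀ c : CechObj y M 0, dC 0 c = 0 → ∃ m : M, cechAug y M m = c) →
      (∀ q : ℕ, q + 2 < n →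
        ∀ c : CechObj y M (q + 1), dC (q + 1) c = 0 → ∃ b : CechObj y M q, dC q b = c) →
      ∃ rs : List R, rs.length = n ∧ RingTheory.Sequence.IsWeaklyRegular M rs ∧
        ∀ r ∈ rs, r ∈ Ideal.span (Set.range y) := by
  induction n with
  | zero =>
    intro M _ _ _ _ _ _
    exact ⟨[], rfl, RingTheory.Sequence.IsWeaklyRegular.nil R M, fun r hr => by simp at hr⟩
  | succ n ih =>
    intro M _ _ _ h0 h1 h2
    obtain ⟨x, hxJ, hx⟩ := exists_isSMulRegular_of_cechAug_injective (h0 n.succ_pos)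
    obtain ⟨rs, hlen, hreg, hmem⟩ := ih (QuotSMulTop x M)
      (fun hn => cech_quot_aug_injective hx (h0 n.succ_pos) (h1 (by omega)))
      (fun hn => cech_quot_exact_zero hx (h1 (by omega)) (h2 0 (by omega)))
      (fun q hq => cech_quot_exact_succ hx q (h2 q (by omega)) (h2 (q + 1) (by omega)))
    exact ⟨x :: rs, by rw [List.length_cons, hlen],
      (RingTheory.Sequence.isWeaklyRegular_cons_iff M x rs).mpr ⟨hx, hreg⟩,
      fun r hr => by
        rcases List.mem_cons.mp hr with rfl | hr
        · exact hxJ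
        · exact hmem r hr⟩

/-- **Depth from the vanishing of Čech cohomology**, `IsRegular` form: under `(y)M ≠ M` the
sequence of `exists_isWeaklyRegular_of_cech_exact` is `M`-regular.
[cite: Grothendieck1968SGA2, Exp. III Prop. 3.3] -/
theorem exists_isRegular_of_cech_exact [IsNoetherianRing R] [Module.Finite R M] (n : ℕ)
    (htop : (⊤ : Submodule R M) ≠ Ideal.span (Set.range y) • ⊤)
    (h0 : 0 < n → ∀ m : M, cechAug y M m = 0 → m = 0)
    (h1 : 1 < n → ∀ c : CechObj y M 0, dC 0 c = 0 → ∃ m : M, cechAug y M m = c)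
    (h2 : ∀ q : ℕ, q + 2 < n →
      ∀ c : CechObj y M (q + 1), dC (q + 1) c = 0 → ∃ b : CechObj y M q, dC q b = c) :
    ∃ rs : List R, rs.length = n ∧ RingTheory.Sequence.IsRegular M rs ∧
      ∀ r ∈ rs, r ∈ Ideal.span (Set.range y) := by
  obtain ⟨rs, hlen, hreg, hmem⟩ := exists_isWeaklyRegular_of_cech_exact n M h0 h1 h2
  refine ⟨rs, hlen, ⟨hreg, fun e => htop (top_unique ?_).symm⟩, hmem⟩
  exact e.le.trans (Submodule.smul_mono_left (Ideal.span_le.mpr fun r hr => hmem r hr))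

/-- **"Čech depth = depth"** (SGA 2 III 3.3, (i) ⇔ (iv), in Čech form): for a finitely generated
module `M` over a Noetherian ring `R` with `(y)M ≠ M`, there is an `M`-regular sequence of length
`n` inside `√(y_1,…,y_s)` iff the extended Čech complex of `M` is exact in degrees `< n`.
[cite: Grothendieck1968SGA2, Exp. III Prop. 3.3] [cite: Eisenbud2005, Prop. A1.16] -/
theorem cech_exact_iff_exists_isRegular [IsNoetherianRing R] [Module.Finite R M] (n : ℕ)
    (htop : (⊤ : Submodule R M) ≠ Ideal.span (Set.range y) • ⊤) :
    (∃ rs : List R, rs.length = n ∧ RingTheory.Sequence.IsRegular M rs ∧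
        ∀ r ∈ rs, r ∈ (Ideal.span (Set.range y)).radical) ↔
      (0 < n → ∀ m : M, cechAug y M m = 0 → m = 0) ∧
      (1 < n → ∀ c : CechObj y M 0, dC 0 c = 0 → ∃ m : M, cechAug y M m = c) ∧
      (∀ q : ℕ, q + 2 < n →
        ∀ c : CechObj y M (q + 1), dC (q + 1) c = 0 → ∃ b : CechObj y M q, dC q b = c) := by
  constructor
  · rintro ⟨rs, rfl, hreg, hrad⟩
    exact cech_exact_of_isRegular rs M hreg hrad
  · rintro ⟨h0, h1, h2⟩
    obtain ⟨rs, hlen, hreg, hmem⟩ := exists_isRegular_of_cech_exact n htop h0 h1 h2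
    exact ⟨rs, hlen, hreg, fun r hr => Ideal.le_radical (hmem r hr)⟩

end Literature.RingTheory.LocalCohomology
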